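import Mathlib
import Summits.MatrixMultiplication.MatrixMultiplication.Theses.PauliSmithLocalisation

/-!
# `OrbitBound` — the Pauli pair-stabiliser count (route PauliSmithLocalisation, item 9880)

For a prime `p`, the Weyl–Heisenberg (generalised Pauli) matrices `P_(x,z) = X^x Z^z` on
`ℂ^((ℤ/p)^k)` (entry `χ(z ⬝ v)` at `(v + x, v)`, `χ(m) = exp(2πi m/p)`) and any non-zero
matrices `a b c`, the set of triples `(g,h,l) ∈ ((𝔽_p^k)²)³` with
`P_g a ∝ a P_h`, `P_h b ∝ b P_l`, `P_l c ∝ c P_g` has at most `p^(3k)` elements.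

Proof (stabiliser formalism, folklore): with `P_g P_g' = χ(z ⬝ x') P_(g+g')` one gets
`P_g P_g' = χ(σ(g,g')) P_g' P_g` for the symplectic form `σ(g,g') = z ⬝ x' - z' ⬝ x`.
The pair stabiliser `S_a = {(g,h) : P_g a ∝ a P_h}` is an `𝔽_p`-subspace of `(𝔽_p^k)⁴`, and
commuting two stabilising pairs past `a ≠ 0` gives `σ(g,g') = σ(h,h')` (the character is
injective), i.e. `S_a` is totally isotropic for the non-degenerate form `σ ⊕ (-σ)`, so
`dim S_a ≤ 2k`.  The set of triples is the subspace `E = π₁₂⁻¹ S_a ∩ π₂₃⁻¹ S_b ∩ π₃₁⁻¹ S_c`; the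
projection `E → S_a`, `(g,h,l) ↦ (g,h)` has kernel embedding into the right stabiliser
`R_b = {m : b ∝ b P_m}`, which is `σ`-isotropic in `(𝔽_p^k)²` (`dim ≤ k`).  Rank–nullity gives
`dim E ≤ 3k`, i.e. `|E| = p^(dim E) ≤ p^(3k)`.  (The third condition is not used.)  No
definitions are declared: the symplectic form is packaged as an existence statement and the
stabiliser subspaces are built inside the counting proof.
-/

set_option linter.dupNamespace false

noncomputable section

open Module Matrix

namespace Summit.MatrixMultiplication.MatrixMultiplication.Theorems

namespace PauliOrbitBound

/-! ### Isotropic subspaces have at most half the dimension -/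

section Isotropic

variable {K W : Type*} [Field K] [AddCommGroup W] [Module K W] [FiniteDimensional K W]

/-- A subspace on which a non-degenerate bilinear form vanishes identically has at most half the
dimension: it lies in its own orthogonal, of complementary dimension. -/
theorem two_mul_finrank_le_of_isotropic (B : LinearMap.BilinForm K W) (hB : B.Nondegenerate)
    (T : Submodule K W) (hT : ∀ x ∈ T, ∀ y ∈ T, B x y = 0) :
    2 * finrank K T ≤ finrank K W := by
  have hle : T ≤ B.orthogonal T := fun x hx =>
    LinearMap.BilinForm.mem_orthogonal_iff.2 fun y hy => hT y hy x hx
  have h1 := Submodule.finrank_mono hle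
  rw [LinearMap.BilinForm.finrank_orthogonal hB T] at h1
  have h2 := Submodule.finrank_le T
  omega

omit [FiniteDimensional K W] in
/-- The form `B ⊕ (-B)` on `W × W` is non-degenerate when `B` is. -/
theorem nondegenerate_sub_prod (B : LinearMap.BilinForm K W) (hB : B.Nondegenerate) :
    (B.compl₁₂ (LinearMap.fst K W W) (LinearMap.fst K W W) -
      B.compl₁₂ (LinearMap.snd K W W) (LinearMap.snd K W W)).Nondegenerate := by
  set B₂ := B.compl₁₂ (LinearMap.fst K W W) (LinearMap.fst K W W) -
      B.compl₁₂ (LinearMap.snd K W W) (LinearMap.snd K W W) with hB₂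
  have hf : ∀ g g', B₂ g g' = B g.1 g'.1 - B g.2 g'.2 := fun _ _ => rfl
  refine ⟨fun g hg => Prod.ext (hB.1 g.1 fun y => ?_) (hB.1 g.2 fun y => ?_),
    fun g hg => Prod.ext (hB.2 g.1 fun y => ?_) (hB.2 g.2 fun y => ?_)⟩
  · simpa [hf] using hg (y, 0)
  · have h := hg (0, y)
    rw [hf, map_zero, sub_eq_zero] at h
    simpa using h.symm
  · simpa [hf] using hg (y, 0)
  · have h := hg (0, y)
    rw [hf, map_zero, LinearMap.zero_apply, sub_eq_zero] at h
    simpa using h.symm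

end Isotropic

/-! ### The standard symplectic form on `K^ι × K^ι` -/

section Symplectic

variable (K : Type*) [Field K] (ι : Type*) [Fintype ι]

/-- The symplectic form `σ((x,z),(x',z')) = z ⬝ x' - z' ⬝ x` on `K^ι × K^ι` exists as a
non-degenerate bilinear form (pair with `(0, e_i)` and `(e_i, 0)` to see the radical is `0`). -/
theorem exists_symplecticForm :
    ∃ B : LinearMap.BilinForm K ((ι → K) × (ι → K)),
      B.Nondegenerate ∧ ∀ g g', B g g' = g.2 ⬝ᵥ g'.1 - g'.2 ⬝ᵥ g.1 := by
  classical
  let B : LinearMap.BilinForm K ((ι → K) × (ι → K)) :=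
    LinearMap.mk₂ K (fun g g' => g.2 ⬝ᵥ g'.1 - g'.2 ⬝ᵥ g.1)
      (fun g₁ g₂ g' => by
        simp only [Prod.fst_add, Prod.snd_add, add_dotProduct, dotProduct_add]; ring)
      (fun c g g' => by
        simp only [Prod.smul_fst, Prod.smul_snd, smul_dotProduct, dotProduct_smul, smul_eq_mul]
        ring)
      (fun g g₁ g₂ => by
        simp only [Prod.fst_add, Prod.snd_add, add_dotProduct, dotProduct_add]; ring)
      (fun c g g' => by
        simp only [Prod.smul_fst, Prod.smul_snd, smul_dotProduct, dotProduct_smul, smul_eq_mul]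
        ring)
  have hB : ∀ g g', B g g' = g.2 ⬝ᵥ g'.1 - g'.2 ⬝ᵥ g.1 := fun _ _ => rfl
  have key : ∀ g : (ι → K) × (ι → K), (∀ g', B g g' = 0) → g = 0 := by
    intro g h
    refine Prod.ext (funext fun i => ?_) (funext fun i => ?_)
    · have h1 := h (0, Pi.single i 1)
      simpa [hB] using h1
    · have h1 := h (Pi.single i 1, 0)
      simpa [hB] using h1
  refine ⟨B, ⟨fun g hg => key g hg, fun g hg => key g fun g' => ?_⟩, hB⟩
  have h1 := hg g'
  rw [hB] at h1 ⊢
  linear_combination -h1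

variable {K ι}

/-- A `σ`-isotropic subspace of `K^ι × K^ι` has dimension `≤ |ι|`. -/
theorem finrank_le_of_isotropic₁ (T : Submodule K ((ι → K) × (ι → K)))
    (hT : ∀ g ∈ T, ∀ g' ∈ T, g.2 ⬝ᵥ g'.1 - g'.2 ⬝ᵥ g.1 = 0) :
    finrank K T ≤ Fintype.card ι := by
  obtain ⟨B, hB, hBf⟩ := exists_symplecticForm K ι
  have h := two_mul_finrank_le_of_isotropic B hB T fun x hx y hy => by
    rw [hBf]; exact hT x hx y hy
  rw [finrank_prod, finrank_fintype_fun_eq_card] at h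
  omega

/-- A `σ ⊕ (-σ)`-isotropic subspace of `(K^ι × K^ι)²`, i.e. one on which
`σ(g,g') = σ(h,h')` for all members `(g,h), (g',h')`, has dimension `≤ 2|ι|`. -/
theorem finrank_le_of_isotropic₂ (T : Submodule K (((ι → K) × (ι → K)) × ((ι → K) × (ι → K))))
    (hT : ∀ g ∈ T, ∀ g' ∈ T,
      g.1.2 ⬝ᵥ g'.1.1 - g'.1.2 ⬝ᵥ g.1.1 = g.2.2 ⬝ᵥ g'.2.1 - g'.2.2 ⬝ᵥ g.2.1) :
    finrank K T ≤ 2 * Fintype.card ι := by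
  obtain ⟨B, hB, hBf⟩ := exists_symplecticForm K ι
  have h := two_mul_finrank_le_of_isotropic _ (nondegenerate_sub_prod B hB) T fun x hx y hy => by
    show B x.1 y.1 - B x.2 y.2 = 0
    rw [hBf, hBf, sub_eq_zero]
    exact hT x hx y hy
  rw [finrank_prod, finrank_prod, finrank_fintype_fun_eq_card] at h
  omega

end Symplectic

/-! ### Weyl–Heisenberg (generalised Pauli) matrices -/

section Pauli

variable {p : ℕ} [Fact p.Prime] {k : ℕ} {χ : AddChar (ZMod p) ℂ}
  {P : (Fin k → ZMod p) → (Fin k → ZMod p) → Matrix (Fin k → ZMod p) (Fin k → ZMod p) ℂ}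

/-- Values of an additive character into `ℂ` are non-zero. -/
theorem addChar_ne_zero (χ : AddChar (ZMod p) ℂ) (m : ZMod p) : χ m ≠ 0 := by
  intro h
  have h1 := AddChar.map_add_eq_mul χ m (-m)
  rw [add_neg_cancel, AddChar.map_zero_eq_one, h, zero_mul] at h1
  exact one_ne_zero h1

/-- `P_0 = 1`. -/
theorem pauli_zero (hP : ∀ x z u v, P x z u v = if u = v + x then χ (z ⬝ᵥ v) else 0) :
    P 0 0 = 1 := by
  ext u v
  simp [hP, Matrix.one_apply]

/-- The Weyl multiplication rule `P_g P_g' = χ(z ⬝ x') P_(g+g')`. -/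
theorem pauli_mul (hP : ∀ x z u v, P x z u v = if u = v + x then χ (z ⬝ᵥ v) else 0)
    (g g' : (Fin k → ZMod p) × (Fin k → ZMod p)) :
    P g.1 g.2 * P g'.1 g'.2 = χ (g.2 ⬝ᵥ g'.1) • P (g + g').1 (g + g').2 := by
  ext u w
  simp only [Matrix.mul_apply, hP, Matrix.smul_apply, smul_eq_mul, mul_ite, mul_zero,
    Finset.sum_ite_eq', Finset.mem_univ, if_true, Prod.fst_add, Prod.snd_add]
  by_cases hu : u = w + (g.1 + g'.1)
  · have hu' : u = w + g'.1 + g.1 := by rw [hu]; abel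
    rw [if_pos hu', if_pos hu, ← AddChar.map_add_eq_mul, ← AddChar.map_add_eq_mul]
    congr 1
    simp only [dotProduct_add, add_dotProduct]
    ring
  · have hu' : ¬ u = w + g'.1 + g.1 := fun h' => hu (by rw [h']; abel)
    rw [if_neg hu', if_neg hu, zero_mul]

/-- `P_(-g) P_g` is a non-zero scalar. -/
theorem pauli_neg_mul (hP : ∀ x z u v, P x z u v = if u = v + x then χ (z ⬝ᵥ v) else 0)
    (g : (Fin k → ZMod p) × (Fin k → ZMod p)) :
    P (-g).1 (-g).2 * P g.1 g.2 = χ ((-g).2 ⬝ᵥ g.1) • (1 : Matrix _ _ ℂ) := by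
  rw [pauli_mul hP, neg_add_cancel, Prod.fst_zero, Prod.snd_zero, pauli_zero hP]

/-- Left multiplication by a Pauli matrix kills only `0`. -/
theorem pauli_mul_ne_zero (hP : ∀ x z u v, P x z u v = if u = v + x then χ (z ⬝ᵥ v) else 0)
    {n : Type*} {a : Matrix (Fin k → ZMod p) n ℂ} (ha : a ≠ 0)
    (g : (Fin k → ZMod p) × (Fin k → ZMod p)) : P g.1 g.2 * a ≠ 0 := by
  intro h
  have h1 : P (-g).1 (-g).2 * (P g.1 g.2 * a) = 0 := by rw [h, Matrix.mul_zero]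
  rw [← Matrix.mul_assoc, pauli_neg_mul hP, Matrix.smul_mul, Matrix.one_mul, smul_eq_zero] at h1
  exact h1.elim (addChar_ne_zero χ _) ha

/-! ### The pair stabiliser `S_a = {(g,h) : P_g a ∝ a P_h}` -/

/-- Composition of two stabilising pairs:
`χ(z_g ⬝ x_g') P_(g+g') a = t t' χ(z_h ⬝ x_h') a P_(h+h')`. -/
theorem stab_add (hP : ∀ x z u v, P x z u v = if u = v + x then χ (z ⬝ᵥ v) else 0)
    (a : Matrix (Fin k → ZMod p) (Fin k → ZMod p) ℂ)
    {g h g' h' : (Fin k → ZMod p) × (Fin k → ZMod p)} {t t' : ℂ}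
    (ht : P g.1 g.2 * a = t • (a * P h.1 h.2)) (ht' : P g'.1 g'.2 * a = t' • (a * P h'.1 h'.2)) :
    χ (g.2 ⬝ᵥ g'.1) • (P (g + g').1 (g + g').2 * a) =
      (t * t' * χ (h.2 ⬝ᵥ h'.1)) • (a * P (h + h').1 (h + h').2) := by
  have e1 : P g.1 g.2 * P g'.1 g'.2 * a = (t * t') • (a * (P h.1 h.2 * P h'.1 h'.2)) := by
    rw [Matrix.mul_assoc, ht', Matrix.mul_smul, ← Matrix.mul_assoc, ht, Matrix.smul_mul,
      smul_smul, Matrix.mul_assoc, mul_comm t' t]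
  rw [pauli_mul hP, pauli_mul hP, Matrix.smul_mul, Matrix.mul_smul, smul_smul] at e1
  exact e1

/-- The stabilising pairs are closed under addition. -/
theorem stab_add_mem (hP : ∀ x z u v, P x z u v = if u = v + x then χ (z ⬝ᵥ v) else 0)
    (a : Matrix (Fin k → ZMod p) (Fin k → ZMod p) ℂ)
    {gh gh' : ((Fin k → ZMod p) × (Fin k → ZMod p)) × ((Fin k → ZMod p) × (Fin k → ZMod p))}
    (hgh : ∃ t : ℂ, P gh.1.1 gh.1.2 * a = t • (a * P gh.2.1 gh.2.2))
    (hgh' : ∃ t : ℂ, P gh'.1.1 gh'.1.2 * a = t • (a * P gh'.2.1 gh'.2.2)) :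
    ∃ t : ℂ, P (gh + gh').1.1 (gh + gh').1.2 * a = t • (a * P (gh + gh').2.1 (gh + gh').2.2) := by
  obtain ⟨t, ht⟩ := hgh
  obtain ⟨t', ht'⟩ := hgh'
  refine ⟨(χ (gh.1.2 ⬝ᵥ gh'.1.1))⁻¹ * (t * t' * χ (gh.2.2 ⬝ᵥ gh'.2.1)), ?_⟩
  have e := congr_arg ((χ (gh.1.2 ⬝ᵥ gh'.1.1))⁻¹ • ·) (stab_add hP a ht ht')
  simp only [smul_smul, inv_mul_cancel₀ (addChar_ne_zero χ _), one_smul] at e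
  simpa using e

/-- **Isotropy**: two stabilising pairs of a non-zero matrix satisfy `σ(g,g') = σ(h,h')`
(commute them past `a`; the character is injective). -/
theorem symp_eq_of_stab (hP : ∀ x z u v, P x z u v = if u = v + x then χ (z ⬝ᵥ v) else 0)
    (hχ : Function.Injective χ) {a : Matrix (Fin k → ZMod p) (Fin k → ZMod p) ℂ} (ha : a ≠ 0)
    {g h g' h' : (Fin k → ZMod p) × (Fin k → ZMod p)} {t t' : ℂ}
    (ht : P g.1 g.2 * a = t • (a * P h.1 h.2)) (ht' : P g'.1 g'.2 * a = t' • (a * P h'.1 h'.2)) :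
    g.2 ⬝ᵥ g'.1 - g'.2 ⬝ᵥ g.1 = h.2 ⬝ᵥ h'.1 - h'.2 ⬝ᵥ h.1 := by
  have e1 := stab_add hP a ht ht'
  have e2 := stab_add hP a ht' ht
  rw [add_comm g' g, add_comm h' h] at e2
  set M := P (g + g').1 (g + g').2 * a with hM
  set N := a * P (h + h').1 (h + h').2 with hN
  have hM0 : M ≠ 0 := pauli_mul_ne_zero hP ha _
  -- from `α • M = γ • N` and `α' • M = γ' • N`: `(α' γ - α γ') • N = 0`
  have key : (χ (g'.2 ⬝ᵥ g.1) * (t * t' * χ (h.2 ⬝ᵥ h'.1)) -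
      χ (g.2 ⬝ᵥ g'.1) * (t' * t * χ (h'.2 ⬝ᵥ h.1))) • N = 0 := by
    rw [sub_smul, ← smul_smul, ← e1, smul_smul, mul_comm, ← smul_smul, e2, smul_smul, sub_self]
  have hN0 : N ≠ 0 := by
    intro hN0
    rw [hN0, smul_zero, smul_eq_zero] at e1
    exact hM0 (e1.resolve_left (addChar_ne_zero χ _))
  have htt : t * t' ≠ 0 := by
    intro htt
    rw [htt, zero_mul, zero_smul, smul_eq_zero] at e1
    exact hM0 (e1.resolve_left (addChar_ne_zero χ _))
  rw [smul_eq_zero] at key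
  have key' := sub_eq_zero.1 (key.resolve_right hN0)
  have key'' : χ (g'.2 ⬝ᵥ g.1 + h.2 ⬝ᵥ h'.1) = χ (g.2 ⬝ᵥ g'.1 + h'.2 ⬝ᵥ h.1) := by
    rw [AddChar.map_add_eq_mul, AddChar.map_add_eq_mul]
    apply mul_left_cancel₀ htt
    linear_combination key'
  have h3 := hχ key''
  linear_combination -h3

/-- A subspace of stabilising pairs of a non-zero matrix is `σ ⊕ (-σ)`-isotropic,
hence has `dim ≤ 2k`. -/
theorem finrank_stab_le (hP : ∀ x z u v, P x z u v = if u = v + x then χ (z ⬝ᵥ v) else 0)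
    (hχ : Function.Injective χ) {a : Matrix (Fin k → ZMod p) (Fin k → ZMod p) ℂ} (ha : a ≠ 0)
    (T : Submodule (ZMod p)
      (((Fin k → ZMod p) × (Fin k → ZMod p)) × ((Fin k → ZMod p) × (Fin k → ZMod p))))
    (hT : ∀ gh ∈ T, ∃ t : ℂ, P gh.1.1 gh.1.2 * a = t • (a * P gh.2.1 gh.2.2)) :
    finrank (ZMod p) T ≤ 2 * k := by
  have h := finrank_le_of_isotropic₂ (K := ZMod p) (ι := Fin k) T ?_
  · simpa using h
  intro gh hgh gh' hgh'
  obtain ⟨t, ht⟩ := hT gh hgh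
  obtain ⟨t', ht'⟩ := hT gh' hgh'
  exact symp_eq_of_stab hP hχ ha ht ht'

/-- A subspace of the right stabiliser `R_a = {m : a ∝ a P_m}` of a non-zero matrix is
`σ`-isotropic, hence has `dim ≤ k`. -/
theorem finrank_rstab_le (hP : ∀ x z u v, P x z u v = if u = v + x then χ (z ⬝ᵥ v) else 0)
    (hχ : Function.Injective χ) {a : Matrix (Fin k → ZMod p) (Fin k → ZMod p) ℂ} (ha : a ≠ 0)
    (T : Submodule (ZMod p) ((Fin k → ZMod p) × (Fin k → ZMod p)))
    (hT : ∀ m ∈ T, ∃ t : ℂ, P (0 : (Fin k → ZMod p) × (Fin k → ZMod p)).1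
      (0 : (Fin k → ZMod p) × (Fin k → ZMod p)).2 * a = t • (a * P m.1 m.2)) :
    finrank (ZMod p) T ≤ k := by
  have h := finrank_le_of_isotropic₁ (K := ZMod p) (ι := Fin k) T ?_
  · simpa using h
  intro m hm m' hm'
  obtain ⟨t, ht⟩ := hT m hm
  obtain ⟨t', ht'⟩ := hT m' hm'
  have e := symp_eq_of_stab hP hχ ha ht ht'
  simp only [Prod.fst_zero, Prod.snd_zero, dotProduct_zero, sub_zero] at e
  exact e.symm

/-! ### Counting the triples -/

/-- **Core count.** For an injective additive character and non-zero `a b` (and any `c`), the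
triples `(g,h,l)` with `P_g a ∝ a P_h`, `P_h b ∝ b P_l`, `P_l c ∝ c P_g` number at most `p^(3k)`:
they form a subspace `E` whose projection to `S_a` (`dim ≤ 2k`) has kernel inside the right
stabiliser of `b` (`dim ≤ k`). -/
theorem ncard_triples_le (hP : ∀ x z u v, P x z u v = if u = v + x then χ (z ⬝ᵥ v) else 0)
    (hχ : Function.Injective χ)
    (a b c : Matrix (Fin k → ZMod p) (Fin k → ZMod p) ℂ) (ha : a ≠ 0) (hb : b ≠ 0) :
    Set.ncard {e : ((Fin k → ZMod p) × (Fin k → ZMod p)) × ((Fin k → ZMod p) × (Fin k → ZMod p)) ×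
        ((Fin k → ZMod p) × (Fin k → ZMod p)) |
      (∃ t : ℂ, P e.1.1 e.1.2 * a = t • (a * P e.2.1.1 e.2.1.2)) ∧
      (∃ t : ℂ, P e.2.1.1 e.2.1.2 * b = t • (b * P e.2.2.1 e.2.2.2)) ∧
      (∃ t : ℂ, P e.2.2.1 e.2.2.2 * c = t • (c * P e.1.1 e.1.2))} ≤ p ^ (3 * k) := by
  -- notation: `V = 𝔽_p^k × 𝔽_p^k` indexes the Pauli matrices
  set V := (Fin k → ZMod p) × (Fin k → ZMod p) with hV
  -- the pair stabiliser of a matrix, as an `𝔽_p`-subspace of `V × V`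
  let S : Matrix (Fin k → ZMod p) (Fin k → ZMod p) ℂ → Submodule (ZMod p) (V × V) := fun d =>
    let S₀ : AddSubmonoid (V × V) :=
      { carrier := {gh | ∃ t : ℂ, P gh.1.1 gh.1.2 * d = t • (d * P gh.2.1 gh.2.2)}
        add_mem' := fun hgh hgh' => stab_add_mem hP d hgh hgh'
        zero_mem' := ⟨1, by simp [pauli_zero hP]⟩ }
    { S₀ with
      smul_mem' := fun r gh hgh => by
        have hr : r • gh = (r.val : ℕ) • gh := by
          rw [← Nat.cast_smul_eq_nsmul (ZMod p), ZMod.natCast_zmod_val]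
        rw [hr]
        exact S₀.nsmul_mem hgh _ }
  have hS : ∀ d (gh : V × V),
      gh ∈ S d ↔ ∃ t : ℂ, P gh.1.1 gh.1.2 * d = t • (d * P gh.2.1 gh.2.2) :=
    fun _ _ => Iff.rfl
  let π₁₂ : (V × V × V) →ₗ[ZMod p] V × V :=
    (LinearMap.fst (ZMod p) V (V × V)).prod
      ((LinearMap.fst (ZMod p) V V).comp (LinearMap.snd (ZMod p) V (V × V)))
  let π₂₃ : (V × V × V) →ₗ[ZMod p] V × V := LinearMap.snd (ZMod p) V (V × V)
  let π₃₁ : (V × V × V) →ₗ[ZMod p] V × V :=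
    ((LinearMap.snd (ZMod p) V V).comp (LinearMap.snd (ZMod p) V (V × V))).prod
      (LinearMap.fst (ZMod p) V (V × V))
  let E : Submodule (ZMod p) (V × V × V) :=
    (S a).comap π₁₂ ⊓ ((S b).comap π₂₃ ⊓ (S c).comap π₃₁)
  have hE : {e : V × V × V |
      (∃ t : ℂ, P e.1.1 e.1.2 * a = t • (a * P e.2.1.1 e.2.1.2)) ∧
      (∃ t : ℂ, P e.2.1.1 e.2.1.2 * b = t • (b * P e.2.2.1 e.2.2.2)) ∧
      (∃ t : ℂ, P e.2.2.1 e.2.2.2 * c = t • (c * P e.1.1 e.1.2))} = (E : Set (V × V × V)) :=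
    Set.ext fun _ => Iff.rfl
  suffices hfin : finrank (ZMod p) E ≤ 3 * k by
    calc Set.ncard _ = Set.ncard (E : Set (V × V × V)) := by rw [hE]
      _ = Nat.card E := by rw [← Nat.card_coe_set_eq, SetLike.coe_sort_coe]
      _ = p ^ finrank (ZMod p) E := by
          rw [Module.natCard_eq_pow_finrank (K := ZMod p), Nat.card_zmod]
      _ ≤ p ^ (3 * k) := Nat.pow_le_pow_right (Fact.out : p.Prime).pos hfin
  -- rank–nullity for the projection `E → S_a`
  let f : E →ₗ[ZMod p] V × V := π₁₂.comp E.subtype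
  have hrange : LinearMap.range f ≤ S a := by
    rintro _ ⟨e, rfl⟩
    exact e.2.1
  have h1 : finrank (ZMod p) (LinearMap.range f) ≤ 2 * k :=
    (Submodule.finrank_mono hrange).trans
      (finrank_stab_le hP hχ ha (S a) fun gh hgh => (hS a gh).1 hgh)
  -- the kernel embeds into the right stabiliser of `b`
  let R := (S b).comap (LinearMap.inr (ZMod p) V V)
  have hker_mem : ∀ e : LinearMap.ker f, ((e : E) : V × V × V).2.2 ∈ R := by
    rintro ⟨⟨e, he⟩, he0⟩
    have h0 : e.2.1 = 0 := congr_arg Prod.snd (LinearMap.mem_ker.1 he0)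
    have hb' : (e.2.1, e.2.2) ∈ S b := he.2.1
    rw [h0] at hb'
    exact hb'
  let ψ : LinearMap.ker f →ₗ[ZMod p] R :=
    { toFun := fun e => ⟨((e : E) : V × V × V).2.2, hker_mem e⟩
      map_add' := fun _ _ => rfl
      map_smul' := fun _ _ => rfl }
  have hψ : Function.Injective ψ := by
    rintro ⟨⟨e, he⟩, he0⟩ ⟨⟨e', he'⟩, he0'⟩ hee
    have h2 : e.2.2 = e'.2.2 := congr_arg (fun x : R => (x : V)) hee
    have h0 := LinearMap.mem_ker.1 he0
    have h0' := LinearMap.mem_ker.1 he0'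
    have h01 : e.1 = 0 := congr_arg Prod.fst h0
    have h02 : e.2.1 = 0 := congr_arg Prod.snd h0
    have h01' : e'.1 = 0 := congr_arg Prod.fst h0'
    have h02' : e'.2.1 = 0 := congr_arg Prod.snd h0'
    have : e = e' := Prod.ext (h01.trans h01'.symm) (Prod.ext (h02.trans h02'.symm) h2)
    subst this
    rfl
  have h2 : finrank (ZMod p) (LinearMap.ker f) ≤ k := by
    refine (LinearMap.finrank_le_finrank_of_injective hψ).trans
      (finrank_rstab_le hP hχ hb R fun m hm => ?_)
    exact (hS b _).1 hm
  have h3 : finrank (ZMod p) (LinearMap.range f) + finrank (ZMod p) (LinearMap.ker f) =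
      finrank (ZMod p) E :=
    LinearMap.finrank_range_add_finrank_ker f
  omega

end Pauli

end PauliOrbitBound

open PauliOrbitBound in
/-- **`OrbitBound`** (item stmt-MatrixMultiplication-9880): for `p` prime, the Pauli matrices
`P_(x,z)` on `ℂ^((ℤ/p)^k)` and non-zero `a b c`, the triples `(g,h,l)` with `P_g a ∝ a P_h`,
`P_h b ∝ b P_l`, `P_l c ∝ c P_g` number at most `p^(3k)`. -/
theorem orbitBound_proof : Theses.PauliSmithLocalisation.OrbitBound := by
  intro p k hp P hP a b c ha hb _
  haveI : NeZero p := ⟨hp.out.ne_zero⟩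
  -- `P` is the Weyl–Heisenberg family for the standard (injective) character `m ↦ e^(2πi m/p)`
  have hP' : ∀ x z u v, P x z u v =
      if u = v + x then (ZMod.stdAddChar (N := p)) (z ⬝ᵥ v) else 0 := by
    intro x z u v
    rw [hP, ZMod.stdAddChar_apply, ZMod.toCircle_apply]
    rfl
  simpa using ncard_triples_le hP' ZMod.injective_stdAddChar a b c ha hb

end Summit.MatrixMultiplication.MatrixMultiplication.Theorems
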